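import Literature.AlgebraicGeometry.Deformation.FrameCoverRestrict
import Literature.AlgebraicGeometry.Modules.CechRefineAlong
import HarnessLib

/-!
# Restricting frame covers and lifted transition matrices along a map of index sets

Setting of `Deformation/DefectCochain.lean`: `j : Y ⟶ Z₀`, `i : Z₀ ⟶ Z₁`, `eI : i_* j_* 𝒪_Y ≅ 𝓘`, an
`𝒪_{Z₀}`-module `F` with a frame cover `C = (U_a, I_a, e_a)_{a ∈ ι}` over opens of `Z₁`, lifts
`L = (T̃_{ab})`, `E = j^*F` with its base framing on `U^Y_a = j⁻¹i⁻¹U_a`, the defect cochain `κ(c)`.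

Given a map of index sets `τ : ι' → ι` and opens `W_b ≤ U_{τ(b)}` (`b ∈ ι'`) — a REFINEMENT in the
sense of Hartshorne III.4 — this file generalises `Deformation/FrameCoverRestrict.lean` (the case
`τ = id`):

* `FrameCover.restrictAlong C τ W hW` — the frame cover over the `W_b` with the restricted frames
  `e_{τ b}|_{i⁻¹W_b}`; `Lifts.restrictAlong` — the restricted lifts `T̃_{τ a, τ b}|_{W_a ∩ W_b}`;
  transition matrices, `TOn`, defects and `κ(defect)` are those of `(C, L)` at the indices `τ(·)`
  (`trans_restrictAlong`, `TOn_restrictAlong`, `defect_restrictAlong`, `kdefAt_restrictAlong`);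
* `op_baseFraming_restrictAlong` — the local matrix endomorphisms of the base framing of the
  restricted cover are those of the base framing at the indices `τ(·)`;
* **`toLocalFamily (κ(c|_τ)) = Cech.restrictFamilyAlong τ (toLocalFamily κ(c))`**
  (`toLocalFamily_defectCochain_restrictAlong`), with the restriction of cochains of local
  homomorphisms along `τ` of `Modules/CechRefineAlong.lean`.

With `τ = pr₁, pr₂ : ι₁ × ι₂ → ι_k` and `W_{(a,b)} = U¹_a ∩ U²_b` this puts the obstruction cocycles of
two data `(C₁, L₁)`, `(C₂, L₂)` for the same `F` on a common cover — the first step of "the class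
does not depend on the choices" (Hartshorne, *Deformation Theory*, proof of Thm. 7.1). Everything is
proved; no named facts.

## References

* R. Hartshorne, *Deformation Theory*, GTM 257 (2010), §7, proof of Thm. 7.1. [Hartshorne2010]
* R. Hartshorne, *Algebraic Geometry*, GTM 52 (1977), III.4, Lemma 4.4 and Ex. 4.4. [Hartshorne1977]
-/

noncomputable section

open CategoryTheory AlgebraicGeometry Opposite TopologicalSpace Limits

namespace Literature.AlgebraicGeometry.Deformation

open Literature.AlgebraicGeometry.Modules Literature.AlgebraicGeometry.Motives

universe u

variable {Y Z₀ Z₁ : Scheme.{u}} {j : Y ⟶ Z₀} {i : Z₀ ⟶ Z₁} {F : Z₀.Modules} {ι ι' : Type u}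

namespace FrameCover

variable (C : FrameCover i F ι) (τ : ι' → ι) (W : ι' → Z₁.Opens) (hW : ∀ b, W b ≤ C.U (τ b))

/-! ### Restricting a frame cover along `τ` -/

/-- **The frame cover over the opens `W_b ≤ U_{τ b}`**, with the restricted frames `e_{τ b}|_{i⁻¹W_b}`.
[cite: Hartshorne2010, §7 (proof of Thm. 7.1)] -/
@[reducible] def restrictAlong : FrameCover i F ι' where
  U := W
  I b := C.I (τ b)
  e b := SheafOfModules.restrictTrivialisation (R := Z₀.ringCatSheaf) (C.incl (hW b)) (C.e (τ b))

/-- The transition matrices of the restricted frame cover are those of `C` at `τ(·)`. [folklore] -/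
theorem trans_restrictAlong (a b : ι') (V : Z₁.Opens) (ha : V ≤ W a) (hb : V ≤ W b) :
    (C.restrictAlong τ W hW).trans a b V ha hb =
      C.trans (τ a) (τ b) V (ha.trans (hW a)) (hb.trans (hW b)) := by
  change transition (SheafOfModules.restrictTrivialisation (R := Z₀.ringCatSheaf) (C.incl (hW a)) (C.e (τ a)))
    (SheafOfModules.restrictTrivialisation (R := Z₀.ringCatSheaf) (C.incl (hW b)) (C.e (τ b))) _ _ =
    transition (C.e (τ a)) (C.e (τ b)) _ _
  rw [transition_restrictTrivialisation]
  exact congrArg₂ (transition (C.e (τ a)) (C.e (τ b))) (Subsingleton.elim _ _) (Subsingleton.elim _ _)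

namespace Lifts

variable {C} (L : C.Lifts)

/-- **The restricted lifts `T̃_{τ a, τ b}|_{W_a ∩ W_b}`.** [cite: Hartshorne2010, §7 (proof of Thm. 7.1)] -/
@[reducible] def restrictAlong : (C.restrictAlong τ W hW).Lifts where
  T a b := L.TOn (τ a) (τ b) (W a ⊓ W b) (inf_le_left.trans (hW a)) (inf_le_right.trans (hW b))
  map_T a b := by rw [L.map_TOn, trans_restrictAlong]

/-- `TOn` of the restricted lifts. [folklore] -/
theorem TOn_restrictAlong (a b : ι') (V : Z₁.Opens) (ha : V ≤ W a) (hb : V ≤ W b) :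
    (L.restrictAlong τ W hW).TOn a b V ha hb = L.TOn (τ a) (τ b) V (ha.trans (hW a)) (hb.trans (hW b)) :=
  L.TOn_map (τ a) (τ b) (inf_le_left.trans (hW a)) (inf_le_right.trans (hW b)) (le_inf ha hb)

/-- The defect of the restricted lifts. [folklore] -/
theorem defect_restrictAlong (a b d : ι') (V : Z₁.Opens) (ha : V ≤ W a) (hb : V ≤ W b) (hd : V ≤ W d) :
    (L.restrictAlong τ W hW).defect a b d V ha hb hd =
      L.defect (τ a) (τ b) (τ d) V (ha.trans (hW a)) (hb.trans (hW b)) (hd.trans (hW d)) := by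
  rw [defect, defect, TOn_restrictAlong, TOn_restrictAlong, TOn_restrictAlong]

variable (eI : (Scheme.Modules.pushforward i).obj ((Scheme.Modules.pushforward j).obj (unitModule Y)) ≅
    idealModule i)

/-- `κ(defect)` of the restricted lifts. [folklore] -/
theorem kdefAt_restrictAlong (a b d : ι') (V : Z₁.Opens) (ha : V ≤ W a) (hb : V ≤ W b) (hd : V ≤ W d) :
    (L.restrictAlong τ W hW).kdefAt eI a b d V ha hb hd =
      L.kdefAt eI (τ a) (τ b) (τ d) V (ha.trans (hW a)) (hb.trans (hW b)) (hd.trans (hW d)) :=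
  matrixOfIdeal_congr eI V (L.defect_restrictAlong τ W hW a b d V ha hb hd) _ _

end Lifts

/-! ### The base framing of the restricted cover -/

variable (j)

/-- The frames of the base framing of the restricted cover are the restricted pulled-back frames.
[folklore] -/
theorem baseFraming_restrictAlong_e (b : ι') :
    ((C.restrictAlong τ W hW).baseFraming j).e b =
      SheafOfModules.restrictTrivialisation (R := Y.ringCatSheaf) ((Opens.map j.base).map (C.incl (hW b)))
        ((C.baseFraming j).e (τ b)) :=
  pullbackFrame_restrictTrivialisation j (C.incl (hW b)) (C.e (τ b))

/-- The transition matrices of the base framing of the restricted cover. [folklore] -/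
theorem T_baseFraming_restrictAlong (a b : ι') (V : Y.Opens) (ha : V ≤ baseOpen j i (W a))
    (hb : V ≤ baseOpen j i (W b)) :
    ((C.restrictAlong τ W hW).baseFraming j).T a b V ha hb =
      (C.baseFraming j).T (τ a) (τ b) V (ha.trans (baseOpen_mono j i (hW a)))
        (hb.trans (baseOpen_mono j i (hW b))) := by
  rw [Framing.T, Framing.T, baseFraming_restrictAlong_e, baseFraming_restrictAlong_e,
    transition_restrictTrivialisation]
  exact congrArg₂ (transition ((C.baseFraming j).e (τ a)) ((C.baseFraming j).e (τ b))) (Subsingleton.elim _ _)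
    (Subsingleton.elim _ _)

/-- **The local matrix endomorphisms of the base framing of the restricted cover are those of the
base framing at `τ(·)`.** [folklore] -/
theorem op_baseFraming_restrictAlong (a z : ι') (V : Y.Opens) (ha : V ≤ baseOpen j i (W a))
    (hz : V ≤ baseOpen j i (W z)) (A : Matrix (C.I (τ a)) (C.I (τ z)) Γ(Y, V)) :
    ((C.restrictAlong τ W hW).baseFraming j).op a z V ha hz A =
      (C.baseFraming j).op (τ a) (τ z) V (ha.trans (baseOpen_mono j i (hW a)))
        (hz.trans (baseOpen_mono j i (hW z))) A := by
  rw [Framing.op, Framing.op, T_baseFraming_restrictAlong, baseFraming_restrictAlong_e,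
    matrixEnd_restrictTrivialisation]
  exact congrArg (fun k => matrixEnd ((C.baseFraming j).e (τ a)) k _) (Subsingleton.elim _ _)

variable {j}

/-! ### The defect cochain of the restricted data -/

namespace Lifts

variable {C} (L : C.Lifts)
  (eI : (Scheme.Modules.pushforward i).obj ((Scheme.Modules.pushforward j).obj (unitModule Y)) ≅
    idealModule i)

include hW in
/-- `W_a ∩ W_b ∩ W_d ≤ U_{τ a} ∩ U_{τ b} ∩ U_{τ d}`. [folklore] -/
lemma inf₃_le_inf₃_along (a b d : ι') : W a ⊓ W b ⊓ W d ≤ C.U (τ a) ⊓ C.U (τ b) ⊓ C.U (τ d) :=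
  inf_le_inf (inf_le_inf (hW a) (hW b)) (hW d)

/-- **The matrices of the defect cochain of the restricted data are those of the defect cochain at
`τ ∘ α`.** [folklore] -/
theorem defectCochain_restrictAlong_mat (α : Fin 3 → ι') (V : Y.Opens)
    (hV : ∀ k, V ≤ ((C.restrictAlong τ W hW).baseFraming j).U (α k)) :
    ((L.restrictAlong τ W hW).defectCochain eI).mat α V hV =
      (L.defectCochain eI).mat (τ ∘ α) V (fun k => (hV k).trans (baseOpen_mono j i (hW (α k)))) := by
  rw [defectCochain_mat, defectCochain_mat, kdefAt_restrictAlong]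
  change _ = (L.kdefAt eI (τ (α 0)) (τ (α 1)) (τ (α (Fin.last 2))) _ _ _ _).map _
  rw [← L.kdefAt_map eI (τ (α 0)) (τ (α 1)) (τ (α (Fin.last 2))) (inf_le_left.trans inf_le_left)
      (inf_le_left.trans inf_le_right) inf_le_right (inf₃_le_inf₃_along τ W hW (α 0) (α 1) (α (Fin.last 2))),
    Matrix.map_map]
  congr 1
  funext x
  exact secRes_secRes _ _ _

/-- Refinement inequality along `τ`: `j⁻¹i⁻¹W_b ≤ j⁻¹i⁻¹U_{τ b}`. [folklore] -/
lemma baseOpen_restrictAlong_le (b : ι') :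
    ((C.restrictAlong τ W hW).baseFraming j).U b ≤ (C.baseFraming j).U (τ b) :=
  baseOpen_mono j i (hW b)

/-- **The family of local endomorphisms of the defect cochain of the data restricted along `τ` is the
restriction along `τ` of that of the original data.** [cite: Hartshorne2010, §7 (proof of Thm. 7.1)] -/
theorem toLocalFamily_defectCochain_restrictAlong :
    ((C.restrictAlong τ W hW).baseFraming j).toLocalFamily ((L.restrictAlong τ W hW).defectCochain eI) =
      Cech.restrictFamilyAlong τ (baseOpen_restrictAlong_le τ W hW)
        ((C.baseFraming j).toLocalFamily (L.defectCochain eI)) := by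
  funext α
  rw [Framing.toLocalFamily_apply, Cech.restrictFamilyAlong_apply, Framing.restrictHom_toLocalFamily,
    defectCochain_restrictAlong_mat, op_baseFraming_restrictAlong]
  rfl

end Lifts

end FrameCover

end Literature.AlgebraicGeometry.Deformation

end
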